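import Summits.MatrixMultiplication.MatrixMultiplication.Theses.IsotypicSaturation
import Literature.Computability.AlgebraicComplexity.AsymptoticRankMatMul

/-!
# MatrixMultiplication / IsotypicSaturation — assembly (rank 1)

Route `MatrixMultiplication/IsotypicSaturation`, item `stmt-MatrixMultiplication-4422`:
`PolytopeSaturation → UnitTensorPolytopeMaximal → ω(ℂ) = 2`.

Glue over proved facts only. Instantiate `PolytopeSaturation` at `s = ⟨2,2,2⟩ = matMulTensor ℂ 2 2 2`
(index types `Fin 2 × Fin 2`, all of cardinality `4`) and `t = ⟨4⟩ = unitTensor ℂ 4`; its domination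
hypothesis is exactly `UnitTensorPolytopeMaximal` at `s`. Hence `F ⟨2,2,2⟩ ≤ F ⟨4⟩ = 4` for every
universal spectral point `F` (`F` is a semiring homomorphism on the tensor semiring and `[⟨4⟩] = 4`).
Strassen duality (`strassen_duality_asymptoticRank_holds`, proved in tree) gives `R̃(⟨2,2,2⟩) ≤ 4`,
`rpow_omega_le_asymptoticRank_matMulTensor` (proved in tree) gives `2^ω ≤ R̃(⟨2,2,2⟩)`, so `ω ≤ 2`,
and `omega_two_le` (flattening lower bound) closes `ω(ℂ) = 2`. The proof is self-contained (it does
not invoke the route file's deciding theorem), so it depends only on the two item definitions and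
Literature.
-/

set_option linter.dupNamespace false

noncomputable section

namespace Summit.MatrixMultiplication.MatrixMultiplication.Theorems

open Literature.Computability.AlgebraicComplexity
open Summit.MatrixMultiplication.MatrixMultiplication.Theses.IsotypicSaturation

/-- A uniform bound `F ⟨2,2,2⟩ ≤ 4` over all universal spectral points forces `ω(ℂ) ≤ 2`:
Strassen duality gives `R̃(⟨2,2,2⟩) ≤ 4`, and `2^ω ≤ R̃(⟨2,2,2⟩)`.
[cite: Strassen1988, §3] [cite: ChristandlVranaZuiddam2023, §2]
[cite: AlmanDuanVassilevskaWilliamsXuXuZhou2025, §3.4] -/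
theorem omega_le_two_of_spectral_bound_four
    (hF4 : ∀ F : SpectralMap ℂ, IsUniversalSpectralPoint ℂ F → F (matMulTensor ℂ 2 2 2) ≤ 4) :
    omega ℂ ≤ 2 := by
  -- Strassen duality (proved in tree): `R̃(⟨2,2,2⟩) ≤ 4`
  have hR : asymptoticRank (matMulTensor ℂ 2 2 2) ≤ 4 :=
    strassen_duality_asymptoticRank.asymptoticRank_le (strassen_duality_asymptoticRank_holds ℂ) _ hF4
  -- `2^ω ≤ R̃(⟨2,2,2⟩) ≤ 4 = 2^2`, so `ω ≤ 2`
  have h2ω : (2 : ℝ) ^ omega ℂ ≤ asymptoticRank (matMulTensor ℂ 2 2 2) := by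
    exact_mod_cast rpow_omega_le_asymptoticRank_matMulTensor ℂ 2
  have h22 : (2 : ℝ) ^ omega ℂ ≤ (2 : ℝ) ^ (2 : ℝ) := by
    calc (2 : ℝ) ^ omega ℂ ≤ asymptoticRank (matMulTensor ℂ 2 2 2) := h2ω
      _ ≤ 4 := hR
      _ = (2 : ℝ) ^ (2 : ℝ) := by norm_num
  exact (Real.rpow_le_rpow_left_iff (by norm_num : (1 : ℝ) < 2)).1 h22

/-- Every universal spectral point takes the value `4` at the unit tensor `⟨4⟩`
(`F` is a semiring homomorphism on the tensor semiring and `[⟨4⟩] = 4`). [cite: Strassen1988, §3] -/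
theorem spectralPoint_unitTensor_four (F : SpectralMap ℂ) (hF : IsUniversalSpectralPoint ℂ F) :
    F (unitTensor ℂ 4) = 4 := by
  have e := TensorClass.evalRingHom_mk hF (unitTensor ℂ 4)
  rw [← TensorClass.natCast_eq_mk, map_natCast] at e
  exact_mod_cast e.symm

/-- Settles `stmt-MatrixMultiplication-4422` (assembly of route `IsotypicSaturation`):
`PolytopeSaturation → UnitTensorPolytopeMaximal → ω(ℂ) = 2`. Instantiate polytope saturation at
`(s, t) = (⟨2,2,2⟩, ⟨4⟩)`, whose domination hypothesis is `UnitTensorPolytopeMaximal` at `s`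
(all three index types `Fin 2 × Fin 2` have cardinality `4`); then `F ⟨2,2,2⟩ ≤ F ⟨4⟩ = 4` for every
universal spectral point, so `ω ≤ 2` (`omega_le_two_of_spectral_bound_four`), and `2 ≤ ω`
(`omega_two_le`, flattening) closes `ω(ℂ) = 2`.
[cite: Strassen1988, §3] [cite: ChristandlVranaZuiddam2023, §2] [cite: Blaser2013, §5] -/
theorem isotypicSaturation_assembly_proof :
    Summit.MatrixMultiplication.MatrixMultiplication.Theses.IsotypicSaturation.Assembly := by
  unfold Summit.MatrixMultiplication.MatrixMultiplication.Theses.IsotypicSaturation.Assembly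
  intro hS hU
  classical
  have h4 : Fintype.card (Fin 2 × Fin 2) ≤ 4 := by simp
  have hF4 : ∀ F : SpectralMap ℂ, IsUniversalSpectralPoint ℂ F → F (matMulTensor ℂ 2 2 2) ≤ 4 := by
    intro F hF
    have h1 : F (matMulTensor ℂ 2 2 2) ≤ F (unitTensor ℂ 4) :=
      hS F hF (matMulTensor ℂ 2 2 2) (unitTensor ℂ 4)
        (fun n lam hn h => hU h4 h4 h4 (matMulTensor ℂ 2 2 2) n lam hn h)
    exact h1.trans_eq (spectralPoint_unitTensor_four F hF)
  show omega ℂ = 2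
  exact le_antisymm (omega_le_two_of_spectral_bound_four hF4) (omega_two_le ℂ)

end Summit.MatrixMultiplication.MatrixMultiplication.Theorems

end
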